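/-
Copyright: the b2b-balaban T⁴-continuum CRUX team, row NE7b OWNER lineage `t4-ne7b-p1` (gen 124). Project licence.
-/
import Summits.QuantumFields.BalabanUV.T4Continuum.Spine.NE7b.SupZdCoarseInverseOperator

/-!
# SUM RULES AT A CONSTANT BACKGROUND: for `V ≡ c ∈ [−λ, Λ]` (so `a + c > 0`), `d ≥ 3`, every mesh, ANY bounded block columns `Ψ` of `H_c`
# and ANY cube limit `M = T_∞⁻¹` ((194)∕(195)): `Σ′_{b′}Ψ_{b′} ≡ 1∕(a + c)`, the rows of the infinite-volume coarse operator sum to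
# `Σ′_{b′}T_∞(b,b′) = 1∕(a + c)`, and the rows of the next-scale Hessian kernel sum to `Σ′_{b′}M(b,b′) = a + c` — the ZERO-MOMENTUM VALUE of
# the infinite-volume next-scale Hessian `(n+1)^dM` at the constant background `c` is `(n+1)^d(a + c)`: the block-volume factor times the
# fine curvature, no further quadratic renormalisation (row NE7b, node U5c; (180)∕(181)∕(186)∕(194)∕(195)∕(203) BY NAME; [folklore])

Cell `pub-balaban`, sub-cell `t4`, spine estimate NE7b (`T4WeightBudget.RelWeightBound`; the cell's OWN estimate — NOT PRINTED in
[Bałaban 1983–89], NOT PROVED).  Crux-route work under `Spine/NE7b/` by the row OWNER (`t4-ne7b-p1` gen 124, file (208)) under FREEZE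
(0)'s crux-prover clause; NOTHING of Bałaban's is named as a Lean object, valued or asserted; no `T4Continuum/Support` leaf typed; no `def`,
no notation (series WRITTEN OUT; `Ψ`, `M` ANY data with their displayed properties); zero `sorry`.  Imports (BY NAME): the OWNER's (203)
`…SupZdCoarseInverseOperator` (`kernel_comp_apply`; through it (195) `zd_coarse_inverse_mul`, (194) `zd_coarse_section_inverse`, (189)
`summable_exp_l1`, `tsum_exp_l1_le`, (186) `zd_coarse_entry_decay`, (181) `zd_bounded_solution_unique`, (180) `zd_propagator_exists`, [B6]
`sum_B_const`), Mathlib's `Summable.tsum_finsetSum`, `tsum_mul_left∕right`, `tsum_eq_single`.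

WHY (located).  (207) made the constant-background Hessian a convolution kernel; its symbol at zero momentum is the row sum, and this
file computes it exactly.  The constant `κ = 1∕(a + c)` solves `H_cκ = 1` (`(n+1)²(−Δ)κ = 0`, the block mean of `κ` is `κ`, so
`H_cκ = (a + c)κ`); the series `Σ′_{b′}Ψ_{b′}` of the block columns converges absolutely ((180)'s decay, (189)), solves the same equation
(the finite stencil through the series; the sources `𝟙_{B n b′}` sum to `1`) and is bounded, so (181) gives `Σ′_{b′}Ψ_{b′} ≡ κ`, whence
`Σ′_{b′}T_∞(b,b′) = (n+1)^{−d}Σ_{B n b}κ = κ`.  Then `MT_∞ = 1` ((195)) applied to the constant function `1` — legitimately, by (203)'s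
exchange `Σ′_{b″}M(b,b″)Σ′_{b′}T(b″,b′)·1 = Σ′_{b′}(Σ′_{b″}M(b,b″)T(b″,b′))·1` for two decaying kernels and a bounded vector — reads
`κ·Σ′_{b″}M(b,b″) = 1`.

WHAT IS PROVED ([folklore]): §1 **`blockColumns_sum_const`** (`V ≡ c` ⟹ `Summable (Ψ · p)` and `Σ′_{b′}Ψ_{b′}(p) = 1∕(a + c)`); §2
**`zd_coarse_inverse_sum_rule`** (THE END: `Σ′_{b′}T_∞(b,b′) = 1∕(a + c)` and `Σ′_{b′}M(b,b′) = a + c`, both absolutely convergent); §3 toy.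

HONEST (what this is NOT).  Constant backgrounds only (the translation-invariant case of (207)); the zero-momentum symbol only (no
Fourier representation of `M` is typed); the LINEAR column only; `d ≥ 3` only; scalar skeleton ((A3), NC-NE7b-α UNRULED); nothing of the
covariant propagators of [B4]–[B6]; nothing of Bałaban's asserted.  BY-NAME EFFECT ON THE WALL: NONE.  NE7b NOT PRINTED ∕ NOT PROVED; spine
PROVED 0∕9; rung (B)+1 — the programme's measures remain FINITE-torus statements; NOT the mass gap, NOT Clay.  HONEST DEPENDENCY:
continuum YM on T⁴ ⇐ BetaPertH ∧ nine spine estimates (0∕9 proved); BetaPertH ⇐ (D1) ∧ (D4) ∧ CAP+tail; G-an2-4 gates asym, D1 and NE2∕3∕4.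
-/

set_option autoImplicit false

noncomputable section

namespace Summit.QuantumFields.BalabanUV.T4Continuum.NE7b.SupZdCoarseInverseSumRule

open Real Filter Topology
open Literature.MathematicalPhysics.QuantumFieldTheory.Balaban1983to89
open B6QGQLower276 (X e blk B side chart mem_B sum_B sum_B_const card_cube blk_chart)
open SupZdPropagatorLimit (zd_propagator_exists)
open SupZdPropagatorUniqueness (zd_bounded_solution_unique)
open SupZdExponentialSums (summable_exp_l1 tsum_exp_l1_le)
open SupZdCoarseOperator (zd_coarse_entry_decay)
open SupZdCoarseInverse (zd_coarse_section_inverse)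
open SupZdCoarseInverseIdentities (zd_coarse_inverse_mul)
open SupZdCoarseInverseOperator (kernel_comp_apply)

variable {d : ℕ}

/-! ## §1. At a constant background the block columns sum to the constant `1∕(a + c)` -/

/-- **`Σ′_{b′}Ψ_{b′} = 1∕(a + c)` AT THE CONSTANT BACKGROUND `V ≡ c`** (`−λ ≤ c ≤ Λ`, so `a + c > 0`): the series of the bounded block columns
converges absolutely at every point ((180)'s decay), solves `H_c(Σ′Ψ_{b′}) = Σ′𝟙_{B n b′} = 1` (the finite stencil through the series) and is
bounded, while the constant `1∕(a + c)` solves the same equation (`(n+1)²(−Δ)` kills constants, the block mean of a constant is the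
constant); (181) identifies them. [folklore] -/
theorem blockColumns_sum_const (hd : 3 ≤ d) (a : ℝ) (ha : 0 < a) {lam Lam : ℝ} (hlam : lam < min 2 a) (hLam : 0 ≤ Lam)
    (n : ℕ) (c : ℝ) (hc : -lam ≤ c) (hc' : c ≤ Lam)
    (Ψ : X d → X d → ℝ) (BΨ : X d → ℝ) (hΨB : ∀ b' p, |Ψ b' p| ≤ BΨ b')
    (hΨ : ∀ b' p, ((n : ℝ) + 1) ^ 2 * ∑ μ, (2 * Ψ b' p - Ψ b' (p + e μ) - Ψ b' (p - e μ))
      + a / ((n : ℝ) + 1) ^ d * ∑ q ∈ B n (blk n p), Ψ b' q + c * Ψ b' p = if blk n p = b' then 1 else 0) (p : X d) :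
    Summable (fun b' : X d => Ψ b' p) ∧ ∑' b' : X d, Ψ b' p = 1 / (a + c) := by
  classical
  have hac : 0 < a + c := by
    have : lam < a := lt_of_lt_of_le hlam (min_le_right _ _)
    linarith
  obtain ⟨C₀, δ₀, hC₀, hδ₀, H180⟩ := zd_propagator_exists (d := d) hd a ha hlam hLam
  -- decay of the block columns ((180) + (181))
  have hΨd : ∀ b' q, |Ψ b' q| ≤ C₀ * exp (-(δ₀ * ∑ i, (((blk n q i - b' i).natAbs : ℕ) : ℝ))) := by
    intro b' q
    obtain ⟨v, hveq, hvdec⟩ := H180 n (fun _ => c) (fun _ => hc) (fun _ => hc') b' 1 (fun p => if blk n p = b' then (1 : ℝ) else 0)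
      (fun p hp => by rw [if_neg hp]) (fun p => by split_ifs <;> simp)
    have hvB : ∀ p, |v p| ≤ C₀ * 1 := fun p =>
      (le_mul_of_one_le_left (abs_nonneg _) (one_le_exp (by positivity))).trans (hvdec p)
    have hΨv : Ψ b' = v := zd_bounded_solution_unique hd a ha hlam hLam n (fun _ => c) (fun _ => hc) (fun _ => hc') _ (Ψ b') v
      (hΨB b') hvB (hΨ b') hveq
    have h := hvdec q
    rw [← hΨv, mul_one] at h
    have hE := exp_pos (δ₀ * ∑ i, (((blk n q i - b' i).natAbs : ℕ) : ℝ))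
    rw [exp_neg, ← div_eq_mul_inv, le_div_iff₀ hE, mul_comm]; exact h
  have hs : ∀ q : X d, Summable fun b' : X d => Ψ b' q := fun q =>
    Summable.of_norm_bounded ((summable_exp_l1 hδ₀ (blk n q)).mul_left C₀) fun b' => by rw [Real.norm_eq_abs]; exact hΨd b' q
  have hbd : ∀ q : X d, |∑' b' : X d, Ψ b' q| ≤ C₀ * (2 * (1 - exp (-δ₀))⁻¹) ^ d := fun q => by
    have h1 : |∑' b' : X d, Ψ b' q| ≤ ∑' b' : X d, |Ψ b' q| := by
      have := norm_tsum_le_tsum_norm (hs q).norm; simpa only [Real.norm_eq_abs] using this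
    have h2 := (hs q).abs.tsum_le_tsum (hΨd · q) ((summable_exp_l1 hδ₀ (blk n q)).mul_left C₀)
    rw [(summable_exp_l1 hδ₀ (blk n q)).tsum_mul_left] at h2
    exact h1.trans (h2.trans (mul_le_mul_of_nonneg_left (tsum_exp_l1_le hδ₀ (blk n q)) hC₀.le))
  -- the series solves `H_c S = 1`
  have hSeq : ∀ q : X d, ((n : ℝ) + 1) ^ 2 * ∑ μ, (2 * (∑' b' : X d, Ψ b' q) - (∑' b' : X d, Ψ b' (q + e μ)) - (∑' b' : X d, Ψ b' (q - e μ)))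
      + a / ((n : ℝ) + 1) ^ d * ∑ q' ∈ B n (blk n q), (∑' b' : X d, Ψ b' q') + c * (∑' b' : X d, Ψ b' q) = 1 := by
    intro q
    have hpt : ∑' b' : X d, (((n : ℝ) + 1) ^ 2 * ∑ μ, (2 * Ψ b' q - Ψ b' (q + e μ) - Ψ b' (q - e μ))
        + a / ((n : ℝ) + 1) ^ d * ∑ q' ∈ B n (blk n q), Ψ b' q' + c * Ψ b' q) = 1 := by
      simp only [hΨ]
      rw [tsum_eq_single (blk n q) (fun b' hb' => by rw [if_neg (Ne.symm hb')]), if_pos rfl]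
    have hS1 : ∀ μ : Fin d, Summable fun b' : X d => 2 * Ψ b' q - Ψ b' (q + e μ) - Ψ b' (q - e μ) :=
      fun μ => (((hs q).mul_left 2).sub (hs (q + e μ))).sub (hs (q - e μ))
    have hS1s : Summable fun b' : X d => ∑ μ, (2 * Ψ b' q - Ψ b' (q + e μ) - Ψ b' (q - e μ)) := summable_sum fun μ _ => hS1 μ
    have hS2 : Summable fun b' : X d => ∑ q' ∈ B n (blk n q), Ψ b' q' := summable_sum fun q' _ => hs q'
    have hT1 : ∑' b' : X d, ∑ μ, (2 * Ψ b' q - Ψ b' (q + e μ) - Ψ b' (q - e μ))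
        = ∑ μ, (2 * (∑' b' : X d, Ψ b' q) - (∑' b' : X d, Ψ b' (q + e μ)) - (∑' b' : X d, Ψ b' (q - e μ))) := by
      rw [Summable.tsum_finsetSum fun μ _ => hS1 μ]
      refine Finset.sum_congr rfl fun μ _ => ?_
      rw [(((hs q).mul_left 2).sub (hs (q + e μ))).tsum_sub (hs (q - e μ)), ((hs q).mul_left 2).tsum_sub (hs (q + e μ)),
        (hs q).tsum_mul_left 2]
    have hT2 : ∑' b' : X d, ∑ q' ∈ B n (blk n q), Ψ b' q' = ∑ q' ∈ B n (blk n q), ∑' b' : X d, Ψ b' q' :=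
      Summable.tsum_finsetSum fun q' _ => hs q'
    have hmain : ∑' b' : X d, (((n : ℝ) + 1) ^ 2 * ∑ μ, (2 * Ψ b' q - Ψ b' (q + e μ) - Ψ b' (q - e μ))
        + a / ((n : ℝ) + 1) ^ d * ∑ q' ∈ B n (blk n q), Ψ b' q' + c * Ψ b' q)
        = ((n : ℝ) + 1) ^ 2 * ∑' b' : X d, ∑ μ, (2 * Ψ b' q - Ψ b' (q + e μ) - Ψ b' (q - e μ))
          + a / ((n : ℝ) + 1) ^ d * ∑' b' : X d, ∑ q' ∈ B n (blk n q), Ψ b' q' + c * ∑' b' : X d, Ψ b' q := by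
      rw [Summable.tsum_add ((hS1s.mul_left _).add (hS2.mul_left _)) ((hs q).mul_left _),
        Summable.tsum_add (hS1s.mul_left _) (hS2.mul_left _), hS1s.tsum_mul_left (((n : ℝ) + 1) ^ 2),
        hS2.tsum_mul_left (a / ((n : ℝ) + 1) ^ d), (hs q).tsum_mul_left c]
    rw [hmain, hT1, hT2] at hpt
    exact hpt
  -- the constant `1∕(a + c)` solves it too
  have hvol : (((n : ℝ) + 1) ^ d) ≠ 0 := by positivity
  have hKeq : ∀ q : X d, ((n : ℝ) + 1) ^ 2 * ∑ _μ : Fin d, (2 * (1 / (a + c)) - 1 / (a + c) - 1 / (a + c))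
      + a / ((n : ℝ) + 1) ^ d * ∑ _q' ∈ B n (blk n q), (1 / (a + c)) + c * (1 / (a + c)) = 1 := by
    intro q
    have hzero : ∑ _μ : Fin d, (2 * (1 / (a + c)) - 1 / (a + c) - 1 / (a + c)) = 0 :=
      Finset.sum_eq_zero fun _ _ => by ring
    have hac' : a + c ≠ 0 := hac.ne'
    rw [hzero, mul_zero, zero_add, sum_B_const]
    field_simp
  have hSK := zd_bounded_solution_unique hd a ha hlam hLam n (fun _ => c) (fun _ => hc) (fun _ => hc') (fun _ => (1 : ℝ))
    (fun q => ∑' b' : X d, Ψ b' q) (fun _ => 1 / (a + c)) hbd (fun _ => le_rfl) hSeq hKeq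
  exact ⟨hs p, congrFun hSK p⟩

/-! ## §2. THE END: the sum rules of the coarse operator and of the next-scale Hessian kernel at a constant background -/

/-- **HEADLINE — SUM RULES AT A CONSTANT BACKGROUND**: `d ≥ 3`, `a > 0`, `λ < min(2,a)`, `Λ ≥ 0`, `V ≡ c ∈ [−λ, Λ]`, ANY bounded block columns
`Ψ` of `H_c` and ANY cube limit `M` (= `T_∞⁻¹`, (194)∕(195)): for every `b`, (i) `Σ′_{b′}T_∞(b,b′) = 1∕(a + c)` (the block mean of §1's
constant); (ii) `Σ′_{b′}M(b,b′) = a + c` — from `MT_∞ = 1` summed over the column index, the double series being absolutely convergent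
((203) `kernel_comp_apply` with `g ≡ 1`).  The zero-momentum value of the infinite-volume next-scale Hessian `(n+1)^dM` at the constant
background `c` is `(n+1)^d(a + c)`: no quadratic renormalisation of the curvature beyond the block-volume factor, every mesh. [folklore] -/
theorem zd_coarse_inverse_sum_rule (hd : 3 ≤ d) (a : ℝ) (ha : 0 < a) {lam Lam : ℝ} (hlam : lam < min 2 a) (hLam : 0 ≤ Lam)
    (n : ℕ) (c : ℝ) (hc : -lam ≤ c) (hc' : c ≤ Lam)
    (Ψ : X d → X d → ℝ) (BΨ : X d → ℝ) (hΨB : ∀ b' p, |Ψ b' p| ≤ BΨ b')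
    (hΨ : ∀ b' p, ((n : ℝ) + 1) ^ 2 * ∑ μ, (2 * Ψ b' p - Ψ b' (p + e μ) - Ψ b' (p - e μ))
      + a / ((n : ℝ) + 1) ^ d * ∑ q ∈ B n (blk n p), Ψ b' q + c * Ψ b' p = if blk n p = b' then 1 else 0)
    (M : X d → X d → ℝ) (hM : ∀ b b' : X d, Tendsto (fun R : ℕ =>
        if h : b ∈ (Fintype.piFinset fun _ : Fin d => Finset.Icc (-(R : ℤ)) R) ∧
            b' ∈ (Fintype.piFinset fun _ : Fin d => Finset.Icc (-(R : ℤ)) R)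
          then (Matrix.of fun c₁ c' : ↥(Fintype.piFinset fun _ : Fin d => Finset.Icc (-(R : ℤ)) R) =>
            (((n : ℝ) + 1) ^ d)⁻¹ * ∑ q ∈ B n (c₁ : X d), Ψ (c' : X d) q)⁻¹ ⟨b, h.1⟩ ⟨b', h.2⟩ else 0)
      atTop (𝓝 (M b b')))
    (b : X d) :
    (Summable (fun b' : X d => (((n : ℝ) + 1) ^ d)⁻¹ * ∑ q ∈ B n b, Ψ b' q) ∧
      ∑' b' : X d, (((n : ℝ) + 1) ^ d)⁻¹ * ∑ q ∈ B n b, Ψ b' q = 1 / (a + c)) ∧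
    (Summable (fun b' : X d => M b b') ∧ ∑' b' : X d, M b b' = a + c) := by
  classical
  have hac : 0 < a + c := by
    have : lam < a := lt_of_lt_of_le hlam (min_le_right _ _)
    linarith
  have hV : ∀ p : X d, -lam ≤ (fun _ : X d => c) p := fun _ => hc
  have hV' : ∀ p : X d, (fun _ : X d => c) p ≤ Lam := fun _ => hc'
  -- (i) the rows of `T_∞`
  have h1 := fun q => blockColumns_sum_const hd a ha hlam hLam n c hc hc' Ψ BΨ hΨB hΨ q
  have hTs : Summable (fun b' : X d => (((n : ℝ) + 1) ^ d)⁻¹ * ∑ q ∈ B n b, Ψ b' q) :=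
    (summable_sum fun q _ => (h1 q).1).mul_left _
  have hTsum : ∑' b' : X d, (((n : ℝ) + 1) ^ d)⁻¹ * ∑ q ∈ B n b, Ψ b' q = 1 / (a + c) := by
    rw [tsum_mul_left, Summable.tsum_finsetSum (fun q _ => (h1 q).1)]
    simp only [fun q => (h1 q).2]
    rw [sum_B_const, ← mul_assoc, inv_mul_cancel₀ (by positivity), one_mul]
  refine ⟨⟨hTs, hTsum⟩, ?_⟩
  -- (ii) the rows of `M`: decay, and `Σ′_{b′}Σ′_{b″}M(b,b″)T(b″,b′) = Σ′_{b″}M(b,b″)·(1∕(a+c))`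
  obtain ⟨Ce, δe, hCe, hδe, H186⟩ := zd_coarse_entry_decay (d := d) hd a ha hlam hLam
  obtain ⟨c₁, δ₁, hc₁, hδ₁, H4⟩ := zd_coarse_section_inverse (d := d) hd a ha hlam hLam
  obtain ⟨T, hT⟩ : ∃ T : X d → X d → ℝ, ∀ b b', T b b' = (((n : ℝ) + 1) ^ d)⁻¹ * ∑ q ∈ B n b, Ψ b' q := ⟨_, fun _ _ => rfl⟩
  have hTd : ∀ b b', |T b b'| ≤ Ce * exp (-(δe * ∑ i, (((b i - b' i).natAbs : ℕ) : ℝ))) := fun b b' => by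
    rw [hT]; exact H186 n (fun _ => c) hV hV' Ψ BΨ hΨB hΨ b b'
  have hMd : ∀ b b', |M b b'| ≤ c₁ * exp (-(δ₁ * ∑ i, (((b i - b' i).natAbs : ℕ) : ℝ))) := fun b b' => by
    refine le_of_tendsto' (hM b b').abs fun R => ?_
    split_ifs with h
    · exact (H4 n (fun _ => c) hV hV' Ψ BΨ hΨB hΨ _ _ (Finset.Subset.refl _)).1 ⟨b, h.1⟩ ⟨b', h.2⟩
    · rw [abs_zero]; positivity
  have hMs : Summable fun b' : X d => M b b' :=
    Summable.of_norm_bounded ((summable_exp_l1 hδ₁ b).mul_left c₁) fun b' => by rw [Real.norm_eq_abs]; exact hMd b b'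
  refine ⟨hMs, ?_⟩
  -- `Σ′_{b″}M(b,b″)(Σ′_{b′}T(b″,b′)·1) = Σ′_{b′}(Σ′_{b″}M(b,b″)T(b″,b′))·1 = Σ′_{b′}δ_{bb′} = 1`
  have hrow : ∀ b'', ∑' b' : X d, T b'' b' * (1 : ℝ) = 1 / (a + c) := fun b'' => by
    simp only [mul_one, hT]
    have h := fun q => blockColumns_sum_const hd a ha hlam hLam n c hc hc' Ψ BΨ hΨB hΨ q
    rw [tsum_mul_left, Summable.tsum_finsetSum (fun q _ => (h q).1)]
    simp only [fun q => (h q).2]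
    rw [sum_B_const, ← mul_assoc, inv_mul_cancel₀ (by positivity), one_mul]
  have hMT : ∀ b', ∑' b'' : X d, M b b'' * T b'' b' = if b = b' then 1 else 0 := fun b' => by
    simp only [hT]; exact (zd_coarse_inverse_mul hd a ha hlam hLam n (fun _ => c) hV hV' Ψ BΨ hΨB hΨ M hM b b').2
  have hcomp := kernel_comp_apply hδ₁ hδe M T hMd hTd (fun _ => (1 : ℝ)) (fun _ => by rw [abs_one]) b
  simp only [hrow, hMT] at hcomp
  have hR : ∑' b'' : X d, (if b = b'' then (1 : ℝ) else 0) * 1 = 1 := by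
    rw [tsum_eq_single b (fun b'' hb'' => by rw [if_neg (Ne.symm hb''), zero_mul]), if_pos rfl, one_mul]
  rw [hR, tsum_mul_right, mul_one_div, div_eq_iff hac.ne'] at hcomp
  linarith [hcomp]

/-! ## §3. Toy -/

/-- Toy (`n = 0`, `a = 1`, `c = 0`, `d = 2`): the constant `1∕(a + c) = 1` solves the mesh-`0` equation with source `1`. -/
example (q : X 2) : (((0 : ℕ) : ℝ) + 1) ^ 2 * ∑ _μ : Fin 2, (2 * (1 / ((1 : ℝ) + 0)) - 1 / (1 + 0) - 1 / (1 + 0))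
      + 1 / (((0 : ℕ) : ℝ) + 1) ^ 2 * ∑ _q' ∈ B 0 (blk 0 q), (1 / ((1 : ℝ) + 0)) + 0 * (1 / ((1 : ℝ) + 0)) = 1 := by
  rw [sum_B_const]; norm_num

end Summit.QuantumFields.BalabanUV.T4Continuum.NE7b.SupZdCoarseInverseSumRule
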